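import Summits.HodgeConjecture.HodgeConjecture.Theorems.F0P3cStCharTSTypeThreeTorus        -- ★ p849521∕p849584 «T3-ALG★» (A)+(B): `exists_irreducible_charpoly_of_nonsplit`
import Summits.HodgeConjecture.HodgeConjecture.Theorems.F0P3cStCharTSTypeThreeCentralizer  -- ★ «T3-CENT★» (LH1-p01): `not_isRoot_charpoly_of_commute_of_isRegularElt` (Z3)
import HarnessLib

/-!
# Crux `H413`, line LH6 (StCharTS) — brick «T3-LINK★»: the (T3) eigenvalue clause of the package `stub_EllipticPackage`, with the TYPE-(3) TORUS
# `T = centraliser of a regular elliptic γ` made explicit, at every non-split finite place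

Cell `hodgecm-mathlib` (D-0151), FLOOR 0, crux item H413 = `stmt-HodgeConjecture-24833`; line LH6 = closer stub `stub_StCharTS`, leaf
`Cruxes/H413/Lines/F0_P3c_StCharTSPaydown.lean` ED. 5, organ (S-𝔇) `stub_EllipticPackage`, conjunct (T3) «let `T` be a Cartan subgroup of type (3)»
[Rogawski1990 L. 12.7.2 (proof) p. 194; §3.6].  DEAL «T3-LINK★» of F0P3b-plan (g23) 2026-09-02T05:40Z to LH1-p03 (g2);
`--supports stmt-HodgeConjecture-24833 --as helper`.  THEOREMS ONLY (no `def`, no instance, no notation, no named fact, no `sorry`); ★-only imports.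

THE LINK.  At a NON-SPLIT place `v` of `L⁺` (`c̄ • w = w` for the places `w ∣ v` of the CM field `L`), `L ⊗ L⁺_v = Π_{w ∣ v} L_w` is the field `L_w`
(★ `LocalRing.isField_of_smul_eq`) and ★ «T3-ALG★» (B) `exists_irreducible_charpoly_of_nonsplit` gives `γ₀ ∈ Gqs L v = U(Φ₃)(L⁺_v)` with IRREDUCIBLE
cubic characteristic polynomial.  Put `T := Subgroup.centralizer {γ₀} ≤ Gqs L v` (the units of the cubic field `L_w[γ₀]`, ★ «T3-CENT★»
`coe_mem_adjoin_of_mem_centralizer`: a Cartan subgroup of TYPE (3)).  Then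
* `γ₀ ∈ T` is regular semisimple (★ (A): irreducible ⟹ separable in characteristic `0`) — `T` has regular elements;
* every REGULAR `γ ∈ T` has a characteristic polynomial WITHOUT ROOT in `L_w` (★ «T3-CENT★» (Z3) `not_isRoot_charpoly_of_commute_of_isRegularElt`:
  `γ ∈ L_w[γ₀]` is scalar — not regular — or has irreducible characteristic polynomial), in particular without root among the norm-one scalars
  `z ∈ U(Φ₁)(L⁺_v)` read at the entry `z 0 0` — the (T3) second conjunct of the leaf, TOKEN FOR TOKEN.
The passage field `K` ↝ the Pi-ring `Π_{w ∣ v} L_w` («the transport») is `IsField.toField` + `IsField.isDomain` + `charZero_of_injective_algebraMap` on the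
SAME underlying ring, so the field-side ★ lemmas apply to the leaf's own matrices verbatim.

* `commute_coe_of_mem_centralizer` — `γ ∈ centralizer {γ₀}` (in `Gqs L v`) ⟹ the MATRICES commute;
* **`exists_typeThree_torus_not_isRoot`** — the statement dealt: `∃ T : Subgroup (Gqs L v), (∃ γ ∈ T, IsRegularElt γ.val) ∧ ∀ γ ∈ T, IsRegularElt γ.val →
  ∀ z : U(Φ₁)(L⁺_v), ¬ χ_γ.IsRoot (z 0 0)`;
* `exists_typeThree_torus_not_isRoot_all` — the same with the stronger inner clause `∀ c : Π_{w ∣ v} L_w, ¬ χ_γ.IsRoot c`.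

HONEST LABEL: count-neutral (T3) package brick (the package's first (T3) conjunct `γ ∈ 𝔇.regG → γ ∈ 𝔇.ellG` is datum-level and stays); HC_CM is proved only
modulo the 7 printed citations (2 remaining: hLiu418 = stmt-HodgeConjecture-24832, h413 = stmt-HodgeConjecture-24833) until rung 0 closes.

## References
* [Rogawski1990] J. D. Rogawski, *Automorphic Representations of Unitary Groups in Three Variables*, Ann. of Math. Stud. 123 (1990): §3.1 p. 19 (regular
  elements), §3.4–3.6 pp. 22–25 (Cartan subgroups of `U(3)`, type (3) = `E¹_K` for a cubic field `K`), Lemma 12.7.2 (proof) p. 194.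
-/

set_option autoImplicit false
-- the mandated namespace has the single-problem summit's repeated segment (`HodgeConjecture.HodgeConjecture`)
set_option linter.dupNamespace false

namespace Summit.HodgeConjecture.HodgeConjecture.Cruxes.H413.F0P3cStCharTSTypeThreeLink

open NumberField IsDedekindDomain
open scoped Matrix
open Literature.NumberTheory.Automorphic Literature.NumberTheory.Automorphic.UnitaryGroup
open Literature.NumberTheory.Rogawski1990
open Summit.HodgeConjecture.HodgeConjecture.Cruxes.H413.F0P3cStCharTSTypeThreeTorus
open Summit.HodgeConjecture.HodgeConjecture.Cruxes.H413.F0P3cStCharTSTypeThreeCentralizer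

variable (L : Type) [Field L] [NumberField L] [IsCMField L]

/-- Members of the centraliser of `γ₀` in `U(Φ₃)(L⁺_v)` commute with `γ₀` AS MATRICES. [cite: Rogawski1990, §3.6] -/
theorem commute_coe_of_mem_centralizer (v : HeightOneSpectrum (𝓞 ↥(maximalRealSubfield L))) (γ₀ : Gqs L v) {γ : Gqs L v}
    (hγ : γ ∈ Subgroup.centralizer ({γ₀} : Set (Gqs L v))) :
    Commute (γ₀.val.val : Matrix (Fin 3) (Fin 3) (UnitaryGroup.LocalRing L v)) (γ.val.val : Matrix (Fin 3) (Fin 3) (UnitaryGroup.LocalRing L v)) := by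
  have h := (Subgroup.mem_centralizer_iff.1 hγ) γ₀ (Set.mem_singleton γ₀)
  -- `h : γ₀ * γ = γ * γ₀` in `Gqs L v`; read in `GL`, then in matrices
  have h' : γ₀.val * γ.val = γ.val * γ₀.val := congrArg Subtype.val h
  have h'' := congrArg Units.val h'
  simp only [Units.val_mul] at h''
  exact h''

/-- **(T3) with the type-(3) torus explicit, ALL scalars**: at a non-split place `v` there is a subgroup `T ≤ U(Φ₃)(L⁺_v)` (the centraliser of a regular
elliptic `γ₀` of ★ «T3-ALG★», i.e. `L_w[γ₀]ˣ ∩ U(Φ₃)`, a Cartan subgroup of type (3)) containing a regular element and such that the characteristic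
polynomial of every regular `γ ∈ T` has NO root in `L ⊗ L⁺_v = L_w`. [cite: Rogawski1990, §3.6; Lemma 12.7.2 (proof) p. 194] -/
theorem exists_typeThree_torus_not_isRoot_all (v : HeightOneSpectrum (𝓞 ↥(maximalRealSubfield L)))
    (hv : ∀ w : PlacesOver L v, IsCMField.complexConj L • w.1 = w.1) :
    ∃ T : Subgroup (Gqs L v),
      (∃ γ ∈ T, IsRegularElt (γ.val : GL (Fin 3) (UnitaryGroup.LocalRing L v))) ∧
      ∀ γ ∈ T, IsRegularElt (γ.val : GL (Fin 3) (UnitaryGroup.LocalRing L v)) →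
        ∀ c : UnitaryGroup.LocalRing L v, ¬ ((γ.val.val : Matrix (Fin 3) (Fin 3) (UnitaryGroup.LocalRing L v)).charpoly).IsRoot c := by
  classical
  have hc1 : IsCMField.complexConj L ≠ 1 := IsCMField.complexConj_ne_one L
  obtain ⟨w⟩ := (inferInstance : Nonempty (PlacesOver L v))
  -- `L ⊗ L⁺_v` is a field of characteristic `0` (one place above `v`)
  have hF : IsField (UnitaryGroup.LocalRing L v) := LocalRing.isField_of_smul_eq (IsCMField.complexConj L) hc1 w (hv w)
  haveI : IsDomain (UnitaryGroup.LocalRing L v) := hF.isDomain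
  haveI : CharZero (UnitaryGroup.LocalRing L v) :=
    charZero_of_injective_algebraMap (algebraMap L (UnitaryGroup.LocalRing L v)).injective
  -- the regular elliptic element of type (3)
  obtain ⟨γ₀, hγ₀⟩ := exists_irreducible_charpoly_of_nonsplit L v hv
  refine ⟨Subgroup.centralizer ({γ₀} : Set (Gqs L v)), ⟨γ₀, ?_, ?_⟩, ?_⟩
  · exact Subgroup.mem_centralizer_iff.2 fun g hg => by rw [Set.mem_singleton_iff.1 hg]
  · -- irreducible ⟹ separable (characteristic `0`), in the field structure of `L ⊗ L⁺_v`
    letI : Field (UnitaryGroup.LocalRing L v) := hF.toField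
    exact isRegularElt_of_irreducible_charpoly_of_charZero _ hγ₀
  · intro γ hγ hreg c
    letI : Field (UnitaryGroup.LocalRing L v) := hF.toField
    exact not_isRoot_charpoly_of_commute_of_isRegularElt hγ₀ γ.val (commute_coe_of_mem_centralizer L v γ₀ hγ) hreg c

/-- **(T3), second conjunct of the leaf's `stub_EllipticPackage`, TOKEN FOR TOKEN, with the torus explicit**: at a non-split place `v` of `L⁺` there is a
subgroup `T ≤ Gqs L v` with a regular element such that for every regular `γ ∈ T` and every `z ∈ U(Φ₁)(L⁺_v)` the characteristic polynomial of `γ` does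
not vanish at the norm-one scalar `z 0 0` («the regular elements of a Cartan subgroup of type (3) are not matched with `H`-classes»).
[cite: Rogawski1990, §3.6; Lemma 12.7.2 (proof) p. 194] -/
theorem exists_typeThree_torus_not_isRoot (v : HeightOneSpectrum (𝓞 ↥(maximalRealSubfield L)))
    (hv : ∀ w : PlacesOver L v, IsCMField.complexConj L • w.1 = w.1) :
    ∃ T : Subgroup (Gqs L v),
      (∃ γ ∈ T, IsRegularElt (γ.val : GL (Fin 3) (UnitaryGroup.LocalRing L v))) ∧
      ∀ γ ∈ T, IsRegularElt (γ.val : GL (Fin 3) (UnitaryGroup.LocalRing L v)) →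
        ∀ z : (UnitaryGroup.cmDatum L 1 (Matrix.of fun i j : Fin 1 => if i.val + j.val + 1 = 1 then (1 : L) else 0)).Local v,
          ¬ ((γ.val.val : Matrix (Fin 3) (Fin 3) (UnitaryGroup.LocalRing L v)).charpoly).IsRoot
            (((z.val.val : Matrix (Fin 1) (Fin 1) (UnitaryGroup.LocalRing L v))) 0 0) := by
  obtain ⟨T, hT, hall⟩ := exists_typeThree_torus_not_isRoot_all L v hv
  exact ⟨T, hT, fun γ hγ hreg z => hall γ hγ hreg _⟩

end Summit.HodgeConjecture.HodgeConjecture.Cruxes.H413.F0P3cStCharTSTypeThreeLink
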